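import Literature.NumberTheory.EllipticCurves.IwasawaModuleFinitePadicIntProofs
import Summits.BirchSwinnertonDyer.BirchSwinnertonDyer.Theorems.ResidualThetaTransportAtTwoLambdaHerbrandCount
import HarnessLib

/-!
# Route `SignedLowerHalves`, crux L `SmallImageLowerHalfBothSigns` (stmt-BirchSwinnertonDyer-23599), line `rtt_w3` v10 — «`μ = 0` IS A RESIDUAL PROPERTY»:
# for a finitely generated torsion `Λ = ℤ_p⟦T⟧`-module, `μ(M) = 0 ⟺ M/(p)M` is finite; hence two such modules with `M₁/(p)M₁ ≃+ M₂/(p)M₂` have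
# `μ(M₁) = 0 ⟺ μ(M₂) = 0` (= Brick C `ResidualMuTransfer` of crux idea `teich`, round 1 g11, the first checkable brick of road T for the E2-K step).

LEAD `cruxlead-stmt-BirchSwinnertonDyer-23599` g6 (cell `bsd-ssimc`; `--supports stmt-BirchSwinnertonDyer-23599 --as helper`). THEOREMS ONLY (no definition, no named fact,
no instance, no `sorry`); pure `Λ`-module algebra on the tree's `muInvariant` / `augIdealP`, assembling `IwasawaModuleFinitePadicInt.muInvariant_eq_zero_of_finite_quotient_augIdealP`
(⇐) with `muInvariant_eq_zero_iff_holds` + `LambdaLowerBound.finite_of_smul_pow_eq_zero` (⇒). BSD / crux L / E2 are NOT proved here; the card `teich` is under review by the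
crux critic — this brick is road-independent algebra.

WHAT (`M`, `M₁`, `M₂` finitely generated torsion modules over `IwasawaAlgebra p`):
* `finite_quotient_augIdealP_of_muInvariant_eq_zero` — `μ(M) = 0 ⇒ M/(p)M` finite (`μ = 0 ⇒` f.g. over `ℤ_p`; a f.g. `ℤ_p`-module killed by `p` is finite);
* ★ `muInvariant_eq_zero_iff_finite_quotient_augIdealP` — `μ(M) = 0 ⟺ Finite (M ⧸ (p)M)`;
* ★ `muInvariant_eq_zero_iff_of_addEquiv_quotient` — `M₁/(p)M₁ ≃+ M₂/(p)M₂ ⇒ (μ(M₁) = 0 ⟺ μ(M₂) = 0)` (`ResidualMuTransfer`), and the one-way form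
  `muInvariant_eq_zero_of_addMonoidHom_injective` (an additive INJECTION `M₂/(p) ↪ M₁/(p)` and `μ(M₁) = 0` give `μ(M₂) = 0`).

References: [GreenbergVatsal2000] §2 Prop. (2.8) («`μ = 0` iff `Sel[p]` finite»); [Washington1997] §13.2; crux idea `Cruxes/SmallImageLowerHalfBothSigns/Ideas/teich.md` (Brick C).
-/

set_option autoImplicit false
set_option linter.dupNamespace false -- D-0017: single-problem summit, the namespace repeats the problem name by design
noncomputable section

open scoped Classical

universe u

namespace Summit.BirchSwinnertonDyer.BirchSwinnertonDyer.Theorems.SmallImageCharSignedSelmer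

open Literature.NumberTheory.EllipticCurves Literature.NumberTheory.EllipticCurves.IwasawaAlgebra

variable (p : ℕ) [Fact p.Prime]

/-- **`μ(M) = 0 ⇒ M/(p)M` is finite** for a finitely generated torsion `Λ`-module (`μ = 0` means f.g. over `ℤ_p`, `muInvariant_eq_zero_iff_holds`; the quotient is then a
f.g. `ℤ_p`-module killed by `p`). [cite: GreenbergVatsal2000, §2 Prop. (2.8)] [cite: Washington1997, §13.2] -/
theorem finite_quotient_augIdealP_of_muInvariant_eq_zero (M : Type u) [AddCommGroup M] [Module (IwasawaAlgebra p) M]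
    [Module.Finite (IwasawaAlgebra p) M] (hM : Module.IsTorsion (IwasawaAlgebra p) M) (h0 : muInvariant p M = 0) :
    Finite (M ⧸ (augIdealP p • (⊤ : Submodule (IwasawaAlgebra p) M))) := by
  letI : Module ℤ_[p] M := Module.compHom M (algebraMap ℤ_[p] (IwasawaAlgebra p))
  haveI : IsScalarTower ℤ_[p] (IwasawaAlgebra p) M := IsScalarTower.of_compHom ℤ_[p] _ M
  haveI : Module.Finite ℤ_[p] M := (muInvariant_eq_zero_iff_holds p M hM).mp h0
  set N : Submodule (IwasawaAlgebra p) M := augIdealP p • ⊤ with hN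
  letI : Module ℤ_[p] (M ⧸ N) := Module.compHom (M ⧸ N) (algebraMap ℤ_[p] (IwasawaAlgebra p))
  haveI : IsScalarTower ℤ_[p] (IwasawaAlgebra p) (M ⧸ N) := IsScalarTower.of_compHom ℤ_[p] _ (M ⧸ N)
  haveI : Module.Finite ℤ_[p] (M ⧸ N) :=
    Module.Finite.of_surjective (N.mkQ.restrictScalars ℤ_[p]) (Submodule.mkQ_surjective N)
  refine LambdaLowerBound.finite_of_smul_pow_eq_zero p (M ⧸ N) 1 fun q ↦ ?_
  obtain ⟨x, rfl⟩ := Submodule.mkQ_surjective N q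
  rw [pow_one]
  change (algebraMap ℤ_[p] (IwasawaAlgebra p) (p : ℤ_[p])) • N.mkQ x = 0
  rw [← map_smul, Submodule.mkQ_apply, Submodule.Quotient.mk_eq_zero, hN]
  refine Submodule.smul_mem_smul ?_ Submodule.mem_top
  rw [← PowerSeries.C_eq_algebraMap]
  exact Ideal.subset_span rfl

/-- ★ **`μ(M) = 0 ⟺ M/(p)M` is finite** for a finitely generated torsion `Λ`-module. [cite: GreenbergVatsal2000, §2 Prop. (2.8)] [cite: Washington1997, §13.2] -/
theorem muInvariant_eq_zero_iff_finite_quotient_augIdealP (M : Type u) [AddCommGroup M] [Module (IwasawaAlgebra p) M]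
    [Module.Finite (IwasawaAlgebra p) M] (hM : Module.IsTorsion (IwasawaAlgebra p) M) :
    muInvariant p M = 0 ↔ Finite (M ⧸ (augIdealP p • (⊤ : Submodule (IwasawaAlgebra p) M))) :=
  ⟨finite_quotient_augIdealP_of_muInvariant_eq_zero p M hM,
    IwasawaModuleFinitePadicInt.muInvariant_eq_zero_of_finite_quotient_augIdealP p M hM⟩

/-- ★ **`ResidualMuTransfer`: `μ = 0` is a residual property.** Two finitely generated torsion `Λ`-modules whose reductions mod `p` are isomorphic as
additive groups have `μ = 0` simultaneously. [cite: GreenbergVatsal2000, §2 Prop. (2.8)] -/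
theorem muInvariant_eq_zero_iff_of_addEquiv_quotient (M₁ : Type u) [AddCommGroup M₁] [Module (IwasawaAlgebra p) M₁]
    [Module.Finite (IwasawaAlgebra p) M₁] (h₁ : Module.IsTorsion (IwasawaAlgebra p) M₁)
    (M₂ : Type u) [AddCommGroup M₂] [Module (IwasawaAlgebra p) M₂]
    [Module.Finite (IwasawaAlgebra p) M₂] (h₂ : Module.IsTorsion (IwasawaAlgebra p) M₂)
    (e : (M₁ ⧸ (augIdealP p • (⊤ : Submodule (IwasawaAlgebra p) M₁))) ≃+ (M₂ ⧸ (augIdealP p • (⊤ : Submodule (IwasawaAlgebra p) M₂)))) :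
    muInvariant p M₁ = 0 ↔ muInvariant p M₂ = 0 := by
  rw [muInvariant_eq_zero_iff_finite_quotient_augIdealP p M₁ h₁, muInvariant_eq_zero_iff_finite_quotient_augIdealP p M₂ h₂]
  exact Equiv.finite_iff e.toEquiv

/-- **One-way form: an additive injection `M₂/(p)M₂ ↪ M₁/(p)M₁` and `μ(M₁) = 0` give `μ(M₂) = 0`.** [cite: GreenbergVatsal2000, §2 Prop. (2.8)] -/
theorem muInvariant_eq_zero_of_addMonoidHom_injective (M₁ : Type u) [AddCommGroup M₁] [Module (IwasawaAlgebra p) M₁]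
    [Module.Finite (IwasawaAlgebra p) M₁] (h₁ : Module.IsTorsion (IwasawaAlgebra p) M₁)
    (M₂ : Type u) [AddCommGroup M₂] [Module (IwasawaAlgebra p) M₂]
    [Module.Finite (IwasawaAlgebra p) M₂] (h₂ : Module.IsTorsion (IwasawaAlgebra p) M₂)
    (f : (M₂ ⧸ (augIdealP p • (⊤ : Submodule (IwasawaAlgebra p) M₂))) →+ (M₁ ⧸ (augIdealP p • (⊤ : Submodule (IwasawaAlgebra p) M₁))))
    (hf : Function.Injective f) (h0 : muInvariant p M₁ = 0) : muInvariant p M₂ = 0 := by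
  haveI := finite_quotient_augIdealP_of_muInvariant_eq_zero p M₁ h₁ h0
  exact IwasawaModuleFinitePadicInt.muInvariant_eq_zero_of_finite_quotient_augIdealP p M₂ h₂ (Finite.of_injective f hf)

end Summit.BirchSwinnertonDyer.BirchSwinnertonDyer.Theorems.SmallImageCharSignedSelmer

end
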